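import Summits.CriticalPhenomena.Ising3DConformalLimit.Theorems.PlantedPinningMoebiusLimitExistsDefectSymmetry
import Summits.CriticalPhenomena.Ising3DConformalLimit.Theorems.PlantedPinningMoebiusLimitExistsSquareTwist
import Summits.CriticalPhenomena.Ising3DConformalLimit.Theorems.PlantedPinningMoebiusLimitExistsLineDeriv
import Literature.Probability.LatticeModels.SCTWardIdentity
import HarnessLib

/-!
# The order-1 Taylor coefficient of the Ising₃ Ward defect at the horizontal square is FREE
(crux `MoebiusLimitExists`, stmt-CriticalPhenomena-1344, line `Sketch` v18, lead prover-line-stmt-CriticalPhenomena-1344-c19-0;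
THEOREM-ONLY, `--supports stmt-CriticalPhenomena-1344`)

The registered residual 7⁗_jet of skeleton v16–v18 is the vanishing of the Taylor jet, at ONE configuration per even level `n ≥ 4`, of the
pointwise `K_{e₀}` defect `D(x) = DS_n(x)[(‖xᵢ‖²e₀ − 2⟪e₀,xᵢ⟫xᵢ)ᵢ] − 2Δ(Σᵢ⟪e₀,xᵢ⟫)S_n(x)` of the limit (`…JetDoor.lean`, p160981).  At the level
`n = 4` and the HORIZONTAL SQUARE `x₀ = (a e₁, a e₂, −a e₁, −a e₂)` (`eₖ = EuclideanSpace.single k 1`, `a ≠ 0`) this file proves that the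
coefficients of order `0` AND `1` vanish for every normalised non-degenerate Euclidean scale-covariant limit of `criticalCorr 3` — no Ward
identity assumed:

* `defect_map_generator_of_symmetry` (pure): if a linear isometry `R` maps the configuration to a relabelling of itself, `R xᵢ = x_{σ i}`, then
  `E_{Rb}(F)(x) = E_b(F)(x)` for every `O(3) × S_n`-invariant level (Z1 + Z2); with `R b = −b` the defect `E_b(F)(x)` vanishes
  (`defect_eq_zero_of_symmetry_neg`) — the common generalisation of the two free-zero theorems of `…DefectSymmetry.lean`;
* the defect `D` of `S 4` vanishes identically on three families through `x₀`: the equal-height configurations (free zeros II), the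
  configurations with `x 0 + x 2 = x 1 + x 3` (central symmetry, free zeros I), and the TWISTED squares `x₀ + t(e₀, −e₀, e₀, −e₀)` (the
  improper quarter-turn `(u₀,u₁,u₂) ↦ (−u₀,−u₂,u₁)` of Y1 permutes their points cyclically and reverses `e₀`);
* the directions of these three families span `(ℝ³)⁴` (explicit decomposition), so by Y3 `fderiv D x₀ = 0`
  (`limit_fderiv_defectK1_eq_zero_at_square`) and `iteratedFDeriv ℝ 1 D x₀ = 0`, `iteratedFDeriv ℝ 0 D x₀ = 0`
  (`limit_jetK1_order_le_one_eq_zero_at_square`).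

So in the jet form of the crux at `(n, x₀) = (4, square)` the conformal content of the Ising₃ four-point function starts at ORDER 2.
References: Di Francesco–Mathieu–Sénéchal 1997 §4.1 (4.18)–(4.19), §4.3.1 (4.51)–(4.54) [FrancescoMathieuSenechal1997].  No definitions, no `sorry`.
-/

noncomputable section

namespace Summit.CriticalPhenomena.Ising3DConformalLimit.MoebiusLimitExistsSquareJet

open Filter Topology Set Function
open Literature.Probability.LatticeModels
open Summit.CriticalPhenomena.Ising3DConformalLimit.MoebiusLimitExistsSketchV16
  (stub_defect_rotate stub_defect_perm stub_squareTwist_isometry stub_fderiv_apply_eq_zero_of_eventually_line)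
open Summit.CriticalPhenomena.Ising3DConformalLimit.MoebiusLimitExistsLocalWard (analyticOnNhd_limit analyticOnNhd_defect)
open Summit.CriticalPhenomena.Ising3DConformalLimit.MoebiusLimitExistsDefectSymmetry
  (defect_neg_left limit_defect_eq_zero_of_centrallySymmetric limit_defect_eq_zero_of_coplanar)
open Summit.CriticalPhenomena.Ising3DConformalLimit.Cruxes.InversionUpgradeNormalised.FreeEndpointGaussianClosure
  (isPermutationSymmetric_of_limit)

/-! ## The covector principle: symmetries of a configuration act on the generator -/

/-- **The covector principle.**  If a linear isometry `R` maps the configuration `x` to a relabelling of itself (`R xᵢ = x_{σ i}`), then for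
every level `F` invariant under the diagonal `O(3)` action and under relabelling, `E_{Rb}(F)(x) = E_b(F)(x)`: the linear functional
`b ↦ E_b(F)(x)` is invariant under the stabiliser of `x` (Z1: `E_{Rb}(R̂x) = E_b(x)`; `R̂x = x ∘ σ`; Z2). [cite: FrancescoMathieuSenechal1997, §4.1 (4.18)–(4.19)] -/
theorem defect_map_generator_of_symmetry (n : ℕ) (F : (Fin n → (EuclideanSpace ℝ (Fin 3))) → ℝ) (Δ : ℝ)
    (hrot : ∀ (R : (EuclideanSpace ℝ (Fin 3)) ≃ₗᵢ[ℝ] (EuclideanSpace ℝ (Fin 3))) (y : Fin n → (EuclideanSpace ℝ (Fin 3))), F (fun i => R (y i)) = F y)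
    (hperm : ∀ (σ : Equiv.Perm (Fin n)) (y : Fin n → (EuclideanSpace ℝ (Fin 3))), F (y ∘ σ) = F y)
    (R : (EuclideanSpace ℝ (Fin 3)) ≃ₗᵢ[ℝ] (EuclideanSpace ℝ (Fin 3))) (σ : Equiv.Perm (Fin n)) (x : Fin n → (EuclideanSpace ℝ (Fin 3)))
    (hx : ∀ i, R (x i) = x (σ i)) (b : (EuclideanSpace ℝ (Fin 3))) :
    fderiv ℝ F x (fun i => ‖x i‖ ^ 2 • R b - (2 * inner ℝ (R b) (x i)) • x i) - 2 * Δ * (∑ i, inner ℝ (R b) (x i)) * F x =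
      fderiv ℝ F x (fun i => ‖x i‖ ^ 2 • b - (2 * inner ℝ b (x i)) • x i) - 2 * Δ * (∑ i, inner ℝ b (x i)) * F x := by
  set 𝓔 : (EuclideanSpace ℝ (Fin 3)) → (Fin n → (EuclideanSpace ℝ (Fin 3))) → ℝ := fun b' y =>
    fderiv ℝ F y (fun i => ‖y i‖ ^ 2 • b' - (2 * inner ℝ b' (y i)) • y i) - 2 * Δ * (∑ i, inner ℝ b' (y i)) * F y with h𝓔
  have h1 : 𝓔 (R b) (fun i => R (x i)) = 𝓔 b x := by
    have h := stub_defect_rotate n F Δ R (fun y => hrot R y) b x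
    simpa only [h𝓔, LinearIsometryEquiv.norm_map, LinearIsometryEquiv.inner_map_map] using h
  have hcfg : (fun i => R (x i)) = x ∘ σ := funext fun i => by rw [comp_apply, hx i]
  have h2 : 𝓔 (R b) (x ∘ σ) = 𝓔 (R b) x := by
    have h := stub_defect_perm n F Δ σ (fun y => hperm σ y) (R b) x
    simpa only [h𝓔] using h
  have h3 : 𝓔 (R b) x = 𝓔 b x := by rw [← h2, ← hcfg, h1]
  simpa only [h𝓔] using h3

/-- **A symmetry reversing the generator kills the defect**: under the hypotheses of the covector principle, if moreover `R b = −b` then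
`E_b(F)(x) = 0`. [cite: FrancescoMathieuSenechal1997, §4.1 (4.18)–(4.19)] -/
theorem defect_eq_zero_of_symmetry_neg (n : ℕ) (F : (Fin n → (EuclideanSpace ℝ (Fin 3))) → ℝ) (Δ : ℝ)
    (hrot : ∀ (R : (EuclideanSpace ℝ (Fin 3)) ≃ₗᵢ[ℝ] (EuclideanSpace ℝ (Fin 3))) (y : Fin n → (EuclideanSpace ℝ (Fin 3))), F (fun i => R (y i)) = F y)
    (hperm : ∀ (σ : Equiv.Perm (Fin n)) (y : Fin n → (EuclideanSpace ℝ (Fin 3))), F (y ∘ σ) = F y)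
    (R : (EuclideanSpace ℝ (Fin 3)) ≃ₗᵢ[ℝ] (EuclideanSpace ℝ (Fin 3))) (σ : Equiv.Perm (Fin n)) (x : Fin n → (EuclideanSpace ℝ (Fin 3)))
    (hx : ∀ i, R (x i) = x (σ i)) (b : (EuclideanSpace ℝ (Fin 3))) (hb : R b = -b) :
    fderiv ℝ F x (fun i => ‖x i‖ ^ 2 • b - (2 * inner ℝ b (x i)) • x i) - 2 * Δ * (∑ i, inner ℝ b (x i)) * F x = 0 := by
  have h := defect_map_generator_of_symmetry n F Δ hrot hperm R σ x hx b
  rw [hb, defect_neg_left] at h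
  linarith

/-! ## The horizontal square, its three free families, and the spanning argument -/

section Limit

variable {ρ : ℝ → ℝ} {Δ : ℝ} {S : CorrFamily 3}

/-- The horizontal square `(a e₁, a e₂, −a e₁, −a e₂)` is non-coincident for `a ≠ 0`. [folklore] -/
theorem square_mem_nonCoincident {a : ℝ} (ha : a ≠ 0) :
    (![a • EuclideanSpace.single 1 1, a • EuclideanSpace.single 2 1, -(a • EuclideanSpace.single 1 1),
        -(a • EuclideanSpace.single 2 1)] : Fin 4 → (EuclideanSpace ℝ (Fin 3))) ∈ NonCoincident 3 4 := by
  rw [mem_nonCoincident]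
  intro i j hij
  have h1 := congrArg (fun u : EuclideanSpace ℝ (Fin 3) => u 1) hij
  have h2 := congrArg (fun u : EuclideanSpace ℝ (Fin 3) => u 2) hij
  have ha2 : a ≠ -a := fun h => ha (by linarith)
  have ha2' : -a ≠ a := fun h => ha (by linarith)
  fin_cases i <;> fin_cases j <;> simp at h1 h2 ⊢ <;>
    first
    | exact absurd h1 ha
    | exact absurd h1.symm ha
    | exact absurd h2 ha
    | exact absurd h2.symm ha
    | exact ha2 h1
    | exact ha2' h1
    | exact ha2 h2
    | exact ha2' h2

/-- **The twisted squares are symmetric under the improper quarter-turn of Y1**: with `R e₁ = e₂`, `R e₂ = −e₁`, `R e₀ = −e₀`, the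
configuration `x_t = (a e₁ + t e₀, a e₂ − t e₀, −a e₁ + t e₀, −a e₂ − t e₀)` satisfies `R (x_t i) = x_t (i + 1)`. [folklore] -/
theorem twist_symmetry (R : (EuclideanSpace ℝ (Fin 3)) ≃ₗᵢ[ℝ] (EuclideanSpace ℝ (Fin 3)))
    (h1 : R (EuclideanSpace.single 1 1) = EuclideanSpace.single 2 1)
    (h2 : R (EuclideanSpace.single 2 1) = -EuclideanSpace.single 1 1)
    (h0 : R (EuclideanSpace.single 0 1) = -EuclideanSpace.single 0 1) (a t : ℝ) :
    ∀ i : Fin 4, R ((![a • EuclideanSpace.single 1 1 + t • EuclideanSpace.single 0 1,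
        a • EuclideanSpace.single 2 1 - t • EuclideanSpace.single 0 1,
        -(a • EuclideanSpace.single 1 1) + t • EuclideanSpace.single 0 1,
        -(a • EuclideanSpace.single 2 1) - t • EuclideanSpace.single 0 1] : Fin 4 → (EuclideanSpace ℝ (Fin 3))) i) =
      (![a • EuclideanSpace.single 1 1 + t • EuclideanSpace.single 0 1,
        a • EuclideanSpace.single 2 1 - t • EuclideanSpace.single 0 1,
        -(a • EuclideanSpace.single 1 1) + t • EuclideanSpace.single 0 1,
        -(a • EuclideanSpace.single 2 1) - t • EuclideanSpace.single 0 1] : Fin 4 → (EuclideanSpace ℝ (Fin 3))) (finRotate 4 i) := by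
  have hr0 : finRotate 4 0 = 1 := by decide
  have hr1 : finRotate 4 1 = 2 := by decide
  have hr2 : finRotate 4 2 = 3 := by decide
  have hr3 : finRotate 4 3 = 0 := by decide
  intro i
  fin_cases i
  · simp [map_add, map_smul, h1, h0, smul_neg, sub_eq_add_neg, hr0]
  · simp [map_smul, h2, h0, smul_neg, sub_eq_add_neg, hr1]
  · simp [map_add, map_neg, map_smul, h1, h0, smul_neg, sub_eq_add_neg, hr2]
  · simp [map_neg, map_smul, h2, h0, smul_neg, sub_eq_add_neg, hr3]

/-- **The `K_{e₀}` defect of `S 4` vanishes on the twisted squares** (covector principle with the improper quarter-turn, which reverses `e₀`).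
[cite: FrancescoMathieuSenechal1997, §4.3.1 (4.51)–(4.54)] -/
theorem limit_defectK1_eq_zero_on_twist (hlim : HasPointwiseScalingLimit (criticalCorr 3) ρ S)
    (hnorm : ∀ n z, z ∉ NonCoincident 3 n → S n z = 0) (heuc : IsEuclideanInvariant S) (Δ' : ℝ) (a t : ℝ) :
    let x : Fin 4 → (EuclideanSpace ℝ (Fin 3)) := ![a • EuclideanSpace.single 1 1 + t • EuclideanSpace.single 0 1,
        a • EuclideanSpace.single 2 1 - t • EuclideanSpace.single 0 1,
        -(a • EuclideanSpace.single 1 1) + t • EuclideanSpace.single 0 1,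
        -(a • EuclideanSpace.single 2 1) - t • EuclideanSpace.single 0 1]
    fderiv ℝ (S 4) x (fun i => ‖x i‖ ^ 2 • (EuclideanSpace.single 0 1 : EuclideanSpace ℝ (Fin 3)) -
        (2 * inner ℝ (EuclideanSpace.single 0 1 : EuclideanSpace ℝ (Fin 3)) (x i)) • x i) -
      2 * Δ' * (∑ i, inner ℝ (EuclideanSpace.single 0 1 : EuclideanSpace ℝ (Fin 3)) (x i)) * S 4 x = 0 := by
  intro x
  obtain ⟨R, h1, h2, h0⟩ := stub_squareTwist_isometry
  have hperm := isPermutationSymmetric_of_limit hlim hnorm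
  exact defect_eq_zero_of_symmetry_neg 4 (S 4) Δ' (fun R' y => heuc.2 4 R' y) (fun σ y => hperm 4 σ y) R (finRotate 4) x
    (twist_symmetry R h1 h2 h0 a t) (EuclideanSpace.single 0 1) h0

/-- **`fderiv` of the `K_{e₀}` defect of `S 4` vanishes at the horizontal square.**  The defect is real-analytic near the square
(`analyticOnNhd_limit`, `analyticOnNhd_defect`) and vanishes, for `t` near `0`, along the lines `x₀ + t v` for `v` in the equal-height
subspace (free zeros II), in the subspace `v 0 + v 2 = v 1 + v 3` (free zeros I) and for the twist `v = (e₀, −e₀, e₀, −e₀)`; these span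
`(ℝ³)⁴`, so every directional derivative at `x₀` vanishes (Y3). [cite: FrancescoMathieuSenechal1997, §4.3.1 (4.51)–(4.54)] -/
theorem limit_fderiv_defectK1_eq_zero_at_square (hρ : ∀ δ ∈ Set.Ioc (0:ℝ) 1, 0 < ρ δ)
    (hlim : HasPointwiseScalingLimit (criticalCorr 3) ρ S)
    (hnorm : ∀ n z, z ∉ NonCoincident 3 n → S n z = 0) (hnd : IsNondegenerateTwoPoint S)
    (heuc : IsEuclideanInvariant S) (hsc : IsScaleCovariant Δ S) {a : ℝ} (ha : a ≠ 0) :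
    fderiv ℝ (fun x : Fin 4 → (EuclideanSpace ℝ (Fin 3)) =>
        fderiv ℝ (S 4) x (fun i => ‖x i‖ ^ 2 • (EuclideanSpace.single 0 1 : EuclideanSpace ℝ (Fin 3)) -
          (2 * inner ℝ (EuclideanSpace.single 0 1 : EuclideanSpace ℝ (Fin 3)) (x i)) • x i) -
        2 * Δ * (∑ i, inner ℝ (EuclideanSpace.single 0 1 : EuclideanSpace ℝ (Fin 3)) (x i)) * S 4 x)
      (![a • EuclideanSpace.single 1 1, a • EuclideanSpace.single 2 1, -(a • EuclideanSpace.single 1 1),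
        -(a • EuclideanSpace.single 2 1)] : Fin 4 → (EuclideanSpace ℝ (Fin 3))) = 0 := by
  -- notation
  set e0 : EuclideanSpace ℝ (Fin 3) := EuclideanSpace.single 0 1 with he0
  set D : (Fin 4 → (EuclideanSpace ℝ (Fin 3))) → ℝ := fun x =>
    fderiv ℝ (S 4) x (fun i => ‖x i‖ ^ 2 • e0 - (2 * inner ℝ e0 (x i)) • x i) - 2 * Δ * (∑ i, inner ℝ e0 (x i)) * S 4 x with hD
  set x₀ : Fin 4 → (EuclideanSpace ℝ (Fin 3)) := ![a • EuclideanSpace.single 1 1, a • EuclideanSpace.single 2 1,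
    -(a • EuclideanSpace.single 1 1), -(a • EuclideanSpace.single 2 1)] with hx₀
  have hx₀NC : x₀ ∈ NonCoincident 3 4 := square_mem_nonCoincident ha
  -- differentiability of `D` at `x₀`
  have hDan : AnalyticOnNhd ℝ D (NonCoincident 3 4) := analyticOnNhd_defect (analyticOnNhd_limit hρ hlim hnorm hnd heuc hsc 4) Δ e0
  have hDdiff : DifferentiableAt ℝ D x₀ := (hDan x₀ hx₀NC).differentiableAt
  -- heights of `x₀` vanish, and `x₀ 0 + x₀ 2 = 0 = x₀ 1 + x₀ 3`
  have he0inner : ∀ u : EuclideanSpace ℝ (Fin 3), inner ℝ e0 u = u 0 := fun u => by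
    rw [he0, EuclideanSpace.inner_single_left]; simp
  have hx₀h : ∀ i, inner ℝ e0 (x₀ i) = 0 := fun i => by
    rw [he0inner]; fin_cases i <;> simp [hx₀]
  have hx₀02 : x₀ 0 + x₀ 2 = 0 := by simp [hx₀]
  have hx₀13 : x₀ 1 + x₀ 3 = 0 := by simp [hx₀]
  -- lines through `x₀` stay non-coincident for small `t`
  have hline : ∀ v : Fin 4 → (EuclideanSpace ℝ (Fin 3)), ∀ᶠ t in 𝓝 (0:ℝ), x₀ + t • v ∈ NonCoincident 3 4 := fun v => by
    have hc : Tendsto (fun t : ℝ => x₀ + t • v) (𝓝 0) (𝓝 x₀) := by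
      have : Continuous fun t : ℝ => x₀ + t • v := continuous_const.add (continuous_id.smul continuous_const)
      simpa using this.tendsto 0
    exact hc.eventually_mem ((isOpen_nonCoincident 3 4).mem_nhds hx₀NC)
  -- (I) equal-height directions
  have hH : ∀ v : Fin 4 → (EuclideanSpace ℝ (Fin 3)), (∀ i, inner ℝ e0 (v i) = 0) → fderiv ℝ D x₀ v = 0 := fun v hv => by
    refine stub_fderiv_apply_eq_zero_of_eventually_line 4 D x₀ v hDdiff ?_
    filter_upwards [hline v] with t ht
    have hplane : ∀ i, inner ℝ e0 ((x₀ + t • v) i) = 0 := fun i => by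
      simp only [Pi.add_apply, Pi.smul_apply, inner_add_right, inner_smul_right, hx₀h i, hv i, mul_zero, add_zero]
    exact limit_defect_eq_zero_of_coplanar hρ hlim hnorm hnd heuc hsc ht e0 0 hplane
  -- (II) centrally symmetric directions
  have hP : ∀ v : Fin 4 → (EuclideanSpace ℝ (Fin 3)), v 0 + v 2 = v 1 + v 3 → fderiv ℝ D x₀ v = 0 := fun v hv => by
    refine stub_fderiv_apply_eq_zero_of_eventually_line 4 D x₀ v hDdiff ?_
    filter_upwards [hline v] with t ht
    set c : EuclideanSpace ℝ (Fin 3) := (t / 2) • (v 0 + v 2) with hc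
    have hsym : ∀ i, (x₀ + t • v) ((Equiv.swap (0 : Fin 4) 2 * Equiv.swap (1 : Fin 4) 3) i) - c = -((x₀ + t • v) i - c) := by
      intro i
      have h02 : x₀ 2 = -x₀ 0 := by rw [← add_eq_zero_iff_eq_neg']; exact hx₀02
      have h13 : x₀ 3 = -x₀ 1 := by rw [← add_eq_zero_iff_eq_neg']; exact hx₀13
      have hv2 : v 2 = v 1 + v 3 - v 0 := by rw [← hv]; abel
      fin_cases i <;>
        simp [Equiv.swap_apply_of_ne_of_ne, Equiv.Perm.mul_apply, hc, h02, h13, hv2, smul_add, smul_sub] <;>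
        module
    exact limit_defect_eq_zero_of_centrallySymmetric hρ hlim hnorm hnd heuc hsc ht c _ hsym e0
  -- (III) the twist direction
  set w : Fin 4 → (EuclideanSpace ℝ (Fin 3)) := ![e0, -e0, e0, -e0] with hw
  have hW : fderiv ℝ D x₀ w = 0 := by
    refine stub_fderiv_apply_eq_zero_of_eventually_line 4 D x₀ w hDdiff (Filter.Eventually.of_forall fun t => ?_)
    have h := limit_defectK1_eq_zero_on_twist hlim hnorm heuc Δ a t
    have hcfg : x₀ + t • w = ![a • EuclideanSpace.single 1 1 + t • EuclideanSpace.single 0 1,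
        a • EuclideanSpace.single 2 1 - t • EuclideanSpace.single 0 1,
        -(a • EuclideanSpace.single 1 1) + t • EuclideanSpace.single 0 1,
        -(a • EuclideanSpace.single 2 1) - t • EuclideanSpace.single 0 1] := by
      funext i
      fin_cases i <;> simp [hx₀, hw, he0, smul_neg, sub_eq_add_neg]
    rw [hD, hcfg]
    exact h
  -- spanning: `V = h + p + λ w` with `h` of equal (zero) heights and `p 0 + p 2 = p 1 + p 3`
  refine ContinuousLinearMap.ext fun V => ?_
  set lam : ℝ := ((V 0) 0 - (V 1) 0 + (V 2) 0 - (V 3) 0) / 4 with hlam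
  set sgn : Fin 4 → ℝ := ![1, -1, 1, -1] with hsgn
  set p : Fin 4 → (EuclideanSpace ℝ (Fin 3)) := fun i => ((V i) 0 - lam * sgn i) • e0 with hp
  set h : Fin 4 → (EuclideanSpace ℝ (Fin 3)) := V - p - lam • w with hh
  have hwsgn : ∀ i, w i = sgn i • e0 := fun i => by fin_cases i <;> simp [hw, hsgn]
  have hV : V = h + p + lam • w := by simp only [hh]; abel
  have hh0 : ∀ i, inner ℝ e0 (h i) = 0 := fun i => by
    have he0e0 : inner ℝ e0 e0 = (1:ℝ) := by rw [he0inner]; simp [he0]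
    simp only [hh, Pi.sub_apply, Pi.smul_apply, hp, hwsgn i, inner_sub_right, inner_smul_right, he0e0, mul_one]
    rw [he0inner (V i)]
    ring
  have hp02 : p 0 + p 2 = p 1 + p 3 := by
    simp only [hp, ← add_smul]
    congr 1
    simp only [hsgn, hlam, Matrix.cons_val_zero, Matrix.cons_val_one, Matrix.cons_val]
    ring
  rw [hV, map_add, map_add, map_smul, hH h hh0, hP p hp02, hW]
  simp

/-- **Orders `0` and `1` of the jet of the `K_{e₀}` defect of `S 4` vanish at the horizontal square** — for every normalised non-degenerate
Euclidean scale-covariant limit of `criticalCorr 3`, with no Ward identity assumed: in the jet form of the crux (`…JetDoor.lean`) at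
`(n, x₀) = (4, square)` the conformal content starts at order `2`. [cite: FrancescoMathieuSenechal1997, §4.3.1 (4.51)–(4.54)] -/
theorem limit_jetK1_order_le_one_eq_zero_at_square (hρ : ∀ δ ∈ Set.Ioc (0:ℝ) 1, 0 < ρ δ)
    (hlim : HasPointwiseScalingLimit (criticalCorr 3) ρ S)
    (hnorm : ∀ n z, z ∉ NonCoincident 3 n → S n z = 0) (hnd : IsNondegenerateTwoPoint S)
    (heuc : IsEuclideanInvariant S) (hsc : IsScaleCovariant Δ S) {a : ℝ} (ha : a ≠ 0) {k : ℕ} (hk : k ≤ 1) :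
    iteratedFDeriv ℝ k (fun x : Fin 4 → (EuclideanSpace ℝ (Fin 3)) =>
        fderiv ℝ (S 4) x (fun i => ‖x i‖ ^ 2 • (EuclideanSpace.single 0 1 : EuclideanSpace ℝ (Fin 3)) -
          (2 * inner ℝ (EuclideanSpace.single 0 1 : EuclideanSpace ℝ (Fin 3)) (x i)) • x i) -
        2 * Δ * (∑ i, inner ℝ (EuclideanSpace.single 0 1 : EuclideanSpace ℝ (Fin 3)) (x i)) * S 4 x)
      (![a • EuclideanSpace.single 1 1, a • EuclideanSpace.single 2 1, -(a • EuclideanSpace.single 1 1),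
        -(a • EuclideanSpace.single 2 1)] : Fin 4 → (EuclideanSpace ℝ (Fin 3))) = 0 := by
  interval_cases k
  · -- order 0: the square is centrally symmetric about the origin
    ext m
    rw [iteratedFDeriv_zero_apply]
    refine limit_defect_eq_zero_of_centrallySymmetric hρ hlim hnorm hnd heuc hsc (square_mem_nonCoincident ha) 0
      (Equiv.swap (0 : Fin 4) 2 * Equiv.swap (1 : Fin 4) 3) (fun i => ?_) (EuclideanSpace.single 0 1)
    fin_cases i <;> simp [Equiv.swap_apply_of_ne_of_ne, Equiv.Perm.mul_apply]
  · -- order 1: `iteratedFDeriv 1 = fderiv`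
    ext m
    rw [iteratedFDeriv_one_apply, limit_fderiv_defectK1_eq_zero_at_square hρ hlim hnorm hnd heuc hsc ha]
    simp

end Limit

/-! ## Registered anchor -/

/-- **Registered anchor of this file — `fderiv` of the `K_{e₀}` Ward defect of the Ising₃ four-point limit vanishes at the horizontal square**
(explicit-binder form of `limit_fderiv_defectK1_eq_zero_at_square`). [cite: FrancescoMathieuSenechal1997, §4.3.1 (4.51)–(4.54)] -/
theorem limit_sctDefectK1_fderiv_eq_zero_at_square : ∀ (ρ : ℝ → ℝ) (Δ : ℝ) (S : Literature.Probability.LatticeModels.CorrFamily 3), (∀ δ ∈ Set.Ioc (0:ℝ) 1, 0 < ρ δ) → Literature.Probability.LatticeModels.HasPointwiseScalingLimit (Literature.Probability.LatticeModels.criticalCorr 3) ρ S → (∀ n z, z ∉ Literature.Probability.LatticeModels.NonCoincident 3 n → S n z = 0) → Literature.Probability.LatticeModels.IsNondegenerateTwoPoint S → Literature.Probability.LatticeModels.IsEuclideanInvariant S → Literature.Probability.LatticeModels.IsScaleCovariant Δ S → ∀ a : ℝ, a ≠ 0 → fderiv ℝ (fun x : Fin 4 → EuclideanSpace ℝ (Fin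 3) => fderiv ℝ (S 4) x (fun i => ‖x i‖ ^ 2 • (EuclideanSpace.single 0 1 : EuclideanSpace ℝ (Fin 3)) - (2 * inner ℝ (EuclideanSpace.single 0 1 : EuclideanSpace ℝ (Fin 3)) (x i)) • x i) - 2 * Δ * (∑ i, inner ℝ (EuclideanSpace.single 0 1 : EuclideanSpace ℝ (Fin 3)) (x i)) * S 4 x) (![a • EuclideanSpace.single 1 1, a • EuclideanSpace.single 2 1, -(a • EuclideanSpace.single 1 1), -(a • EuclideanSpace.single 2 1)] : Fin 4 → EuclideanSpace ℝ (Fin 3)) = 0 :=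
  fun _ _ _ hρ hlim hnorm hnd heuc hsc _ ha => limit_fderiv_defectK1_eq_zero_at_square hρ hlim hnorm hnd heuc hsc ha

end Summit.CriticalPhenomena.Ising3DConformalLimit.MoebiusLimitExistsSquareJet

end
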